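import Mathlib
import Summits.ValiantsHypothesis.ValiantsHypothesis.Theorems.FeketeSOSCharPSparseSOSDifferenceSetBarrier

/-!
# Crux `FeketeSOS.CharPSparseSOS` (stmt-ValiantsHypothesis-14989) — the difference-set wall, clique form:
an additive power below Hanson–Petridis for Sidon Paley cliques

A *Sidon Paley clique* is a set `Q ⊆ 𝔽_p` such that `a − b` is a non-zero quadratic residue for all
`a ≠ b` in `Q` (`legendreSym p (a − b).val = 1`; for `|Q| ≥ 2` this forces `−1 ∈ QR`, i.e. `p ≡ 1 (mod 4)`:
the cliques of the Paley graph) and the ordered differences of distinct pairs are pairwise distinct.  Its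
`|Q|² − |Q|` ordered off-diagonal differences are distinct elements of QR, so COUNTING gives
`|Q|(|Q| − 1) ≤ (p − 1)/2`, i.e. `|Q| ≤ √(p/2) + 1/2` — and this is exactly the best bound in print for ALL
Paley cliques, B. Hanson, G. Petridis, *Refined estimates concerning sumsets contained in the roots of unity*,
Proc. LMS 122 (2021), Cor. 5 (tree: `Literature.Combinatorics.Additive.HansonPetridis.
card_mul_card_sub_one_le_of_sub_subset_rootsOfUnity`, p139086): on the difference side Stepanov's method
reaches exactly the Sidon counting bound, Sidon-free — the precise twin of the sum side, where Stepanov with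
the diagonal cure reaches exactly the weak-Sidon counting bound (Yip 2025; tree p160049, p160569).

`sidonPaleyClique_card_le_of_charPSparseSOS` : the crux `CharPSparseSOS` (with its exponent `δ`) implies
that every Sidon Paley clique has `|Q| ≤ √(p/2) − p^δ/3 + 13/2` for all large primes `p` — an additive POWER
below Hanson–Petridis on the Sidon sub-class.  (Its exact extremal case `|Q|(|Q|−1) = (p−1)/2` — the
Lev–Sonn unique-difference sets, Q. J. Math. 2017 — is CLASSIFIED by A. Kalmynin, arXiv:2504.10202 (2025),
Thm. 4: `(A, −A)` is `d`-critical only for `d ∈ {2, 6}` or `(p, d) = (41, 20)`, i.e. `p ∈ {5, 13, 41}`; so the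
bound in print is `|Q|(|Q|−1) ≤ (p−1)/2 − 1` for `p > 41` — ONE unit of `|Q|(|Q|−1)` below Hanson–Petridis, by
the same polynomials, against the `≍ p^{1/2+δ}` units the crux needs.  Correction of the first revision of this
docstring, p164541, which called the exact case open.)  Proof: transport `Q` to its
representatives `Q' ⊆ [0, p)`; by Sidon every residue carries at most one ordered off-diagonal pair of `Q'`
and by the clique property every carried residue is a non-zero quadratic residue, so the Hamming error of
`dQ_far_from_QR_of_charPSparseSOS` is the set of uncovered non-zero residues, `2·#Err ≤ (p−1) − 2(|Q|²−|Q|)`,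
and the eight-square barrier reads `√p·p^δ ≤ 4|Q| + (p − 1) − 2(|Q|² − |Q|) + 13√p + 13`, i.e.
`2|Q|² − 6|Q| ≤ p + 12 + 13√p − √p·p^δ`, whence `|Q| ≤ √(p/2) − p^δ/3 + 13/2` for `p ≥ 289`
(`dsb_real_bookkeeping`, using `4/3 ≤ √2 ≤ 99/70`).  Together with `coreSumClique_of_charPSparseSOS`
(sum side, p146769) this puts BOTH classical faces of the square-root barrier under the crux: any proof of
`CharPSparseSOS` improves the Paley sum-clique counting bound AND the Hanson–Petridis clique bound (on Sidon
cliques) by an additive power.  (Lead c9 of the crux; `--supports` stmt-ValiantsHypothesis-14989.)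
-/

-- `Summit.ValiantsHypothesis.ValiantsHypothesis.…` is the tree's mandated single-conjunct layout (Sub = Summit).
set_option linter.dupNamespace false

namespace Summit.ValiantsHypothesis.ValiantsHypothesis.Theorems.CharPSparseSOSTwoCusp

open Finset
open Summit.ValiantsHypothesis.ValiantsHypothesis.Theorems.CharPSparseSOSTraceBias (wc_two_card_qr)

/-! ## Transport of a Sidon Paley clique to its representatives in `[0, p)` -/

/-- Values of differences: `(a − b).val = (a.val + (p − b.val)) % p` in `ZMod p`. -/
theorem dsb_val_sub {p : ℕ} [Fact p.Prime] (a b : ZMod p) :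
    (a - b).val = (a.val + (p - b.val)) % p := by
  rw [sub_eq_add_neg, ZMod.val_add, ZMod.neg_val]
  split_ifs with hb
  · subst hb
    rw [ZMod.val_zero, Nat.sub_zero, add_zero, Nat.add_mod_right, Nat.mod_eq_of_lt (ZMod.val_lt a)]
  · rfl

/-- **Sidon, transported**: every residue `n` carries at most one ordered off-diagonal pair `(x, y)` of
representatives with `x − y ≡ n (mod p)`. -/
theorem dsb_pairCount_le_one {p : ℕ} [Fact p.Prime] (Q : Finset (ZMod p))
    (hsidon : ∀ a ∈ Q, ∀ b ∈ Q, ∀ c ∈ Q, ∀ d ∈ Q, a ≠ b → c ≠ d → a - b = c - d → a = c ∧ b = d)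
    (n : ℕ) :
    (((Q.image ZMod.val).offDiag).filter
        (fun ab : ℕ × ℕ => (ab.1 + (p - ab.2)) % p = n)).card ≤ 1 := by
  refine card_le_one.2 fun x hx y hy => ?_
  simp only [mem_filter, mem_offDiag, mem_image] at hx hy
  obtain ⟨⟨⟨a₁, ha₁, hx₁⟩, ⟨a₂, ha₂, hx₂⟩, hxne⟩, hxn⟩ := hx
  obtain ⟨⟨⟨b₁, hb₁, hy₁⟩, ⟨b₂, hb₂, hy₂⟩, hyne⟩, hyn⟩ := hy
  have ha12 : a₁ ≠ a₂ := fun h => hxne (by rw [← hx₁, ← hx₂, h])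
  have hb12 : b₁ ≠ b₂ := fun h => hyne (by rw [← hy₁, ← hy₂, h])
  have hdiff : a₁ - a₂ = b₁ - b₂ := by
    apply ZMod.val_injective p
    rw [dsb_val_sub, dsb_val_sub, hx₁, hx₂, hy₁, hy₂, hxn, hyn]
  obtain ⟨h1, h2⟩ := hsidon a₁ ha₁ a₂ ha₂ b₁ hb₁ b₂ hb₂ ha12 hb12 hdiff
  subst h1; subst h2
  exact Prod.ext (hx₁.symm.trans hy₁) (hx₂.symm.trans hy₂)

/-- **Paley clique, transported**: a residue carrying an ordered off-diagonal pair of representatives is a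
non-zero quadratic residue. -/
theorem dsb_qr_of_pairCount_ne_zero {p : ℕ} [Fact p.Prime] (Q : Finset (ZMod p))
    (hclique : ∀ a ∈ Q, ∀ b ∈ Q, a ≠ b → legendreSym p (a - b).val = 1) (n : ℕ)
    (hn : (((Q.image ZMod.val).offDiag).filter
        (fun ab : ℕ × ℕ => (ab.1 + (p - ab.2)) % p = n)).card ≠ 0) :
    n ≠ 0 ∧ legendreSym p n = 1 := by
  obtain ⟨x, hx⟩ := card_ne_zero.1 hn
  simp only [mem_filter, mem_offDiag, mem_image] at hx
  obtain ⟨⟨⟨a₁, ha₁, hx₁⟩, ⟨a₂, ha₂, hx₂⟩, hxne⟩, hxn⟩ := hx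
  have ha12 : a₁ ≠ a₂ := fun h => hxne (by rw [← hx₁, ← hx₂, h])
  have h := hclique a₁ ha₁ a₂ ha₂ ha12
  rw [dsb_val_sub, hx₁, hx₂, hxn] at h
  refine ⟨?_, h⟩
  rintro rfl
  rw [Nat.cast_zero, legendreSym.at_zero] at h
  exact zero_ne_one h

/-- The off-diagonal difference counts over all residues add up to the number of off-diagonal pairs. -/
theorem dsb_sum_count (p : ℕ) (hp : 0 < p) (Q : Finset ℕ) :
    ∑ n ∈ range p, ((Q.offDiag).filter (fun ab : ℕ × ℕ => (ab.1 + (p - ab.2)) % p = n)).card =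
      Q.offDiag.card := by
  rw [card_eq_sum_card_fiberwise (f := fun ab : ℕ × ℕ => (ab.1 + (p - ab.2)) % p) (t := range p)
    (fun ab _ => mem_coe.2 (mem_range.2 (Nat.mod_lt _ hp)))]

/-- **Error count of a Sidon Paley clique.**  For the representatives `Q'` of a Sidon Paley clique `Q`, the
Hamming error `#{n < p : d_{Q'}(n) ≠ 1_QR(n)}` satisfies `2·#Err ≤ (p − 1) − 2(|Q|² − |Q|)`: the error set
consists of the uncovered non-zero quadratic residues, and the `|Q|² − |Q|` ordered off-diagonal pairs cover
pairwise distinct non-zero residues. -/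
theorem dsb_two_card_err_le {p : ℕ} [Fact p.Prime] (hp2 : p ≠ 2) (Q : Finset (ZMod p))
    (hclique : ∀ a ∈ Q, ∀ b ∈ Q, a ≠ b → legendreSym p (a - b).val = 1)
    (hsidon : ∀ a ∈ Q, ∀ b ∈ Q, ∀ c ∈ Q, ∀ d ∈ Q, a ≠ b → c ≠ d → a - b = c - d → a = c ∧ b = d) :
    2 * (((range p).filter (fun n => (((Q.image ZMod.val).offDiag).filter
          (fun ab : ℕ × ℕ => (ab.1 + (p - ab.2)) % p = n)).card ≠
            (if n ≠ 0 ∧ legendreSym p n = 1 then 1 else 0))).card : ℤ) ≤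
      ((p : ℤ) - 1) - 2 * ((Q.card : ℤ) * Q.card - Q.card) := by
  have hp : p.Prime := Fact.out
  set Q' : Finset ℕ := Q.image ZMod.val with hQ'
  set cnt : ℕ → ℕ := fun n => ((Q'.offDiag).filter
      (fun ab : ℕ × ℕ => (ab.1 + (p - ab.2)) % p = n)).card with hcnt
  set R : Finset ℕ := (range p).filter (fun n : ℕ => n ≠ 0 ∧ legendreSym p n = 1) with hR
  set G : Finset ℕ := (range p).filter (fun n : ℕ => cnt n = 1) with hG
  set Err : Finset ℕ := (range p).filter (fun n => cnt n ≠
      (if n ≠ 0 ∧ legendreSym p n = 1 then 1 else 0)) with hErr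
  have hle1 : ∀ n, cnt n ≤ 1 := fun n => dsb_pairCount_le_one Q hsidon n
  have hqr : ∀ n, cnt n ≠ 0 → n ≠ 0 ∧ legendreSym p n = 1 := fun n hn =>
    dsb_qr_of_pairCount_ne_zero Q hclique n hn
  -- the good residues lie in `R`, the error residues lie in `R \ G`
  have hGR : G ⊆ R := by
    intro n hn
    rw [hG, mem_filter] at hn
    rw [hR, mem_filter]
    exact ⟨hn.1, hqr n (by rw [hn.2]; exact one_ne_zero)⟩
  have hErrR : Err ⊆ R \ G := by
    intro n hn
    rw [hErr, mem_filter] at hn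
    rw [mem_sdiff, hR, hG, mem_filter, mem_filter]
    have h01 : cnt n = 0 ∨ cnt n = 1 := by have := hle1 n; omega
    rcases h01 with h0 | h1
    · refine ⟨⟨hn.1, ?_⟩, fun h => by rw [h0] at h; exact zero_ne_one h.2⟩
      by_contra hc
      exact hn.2 (by rw [h0, if_neg hc])
    · exact absurd (by rw [h1, if_pos (hqr n (by rw [h1]; exact one_ne_zero))]) hn.2
  have hcardErr : Err.card + G.card ≤ R.card := by
    have h1 := card_le_card hErrR
    rw [card_sdiff_of_subset hGR] at h1
    have h2 := card_le_card hGR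
    omega
  -- `#G = Σ_n cnt n = #offDiag = |Q|² − |Q|`
  have hGsum : G.card = ∑ n ∈ range p, cnt n := by
    rw [hG, card_filter]
    refine sum_congr rfl fun n _ => ?_
    have h01 : cnt n = 0 ∨ cnt n = 1 := by have := hle1 n; omega
    rcases h01 with h0 | h1
    · rw [h0]; simp
    · rw [h1]; simp
  have hpairs : ∑ n ∈ range p, cnt n = Q'.offDiag.card := dsb_sum_count p hp.pos Q'
  have hoff : Q'.offDiag.card = Q'.card * Q'.card - Q'.card := offDiag_card Q'
  have hcardQ' : Q'.card = Q.card := csq_card_image_val Q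
  have hRcard := wc_two_card_qr p hp2
  -- assemble (in `ℤ`)
  have h1 : (2 : ℤ) * Err.card + 2 * G.card ≤ 2 * R.card := by exact_mod_cast (by omega)
  have h2 : (G.card : ℤ) = (Q.card : ℤ) * Q.card - Q.card := by
    rw [hGsum, hpairs, hoff, hcardQ', Nat.cast_sub (Nat.le_mul_self _), Nat.cast_mul]
  have hR' : (2 : ℤ) * R.card = (p : ℤ) - 1 := hRcard
  linarith

/-! ## The wall, clique form: an additive power below Hanson–Petridis for Sidon Paley cliques -/

/-- Real bookkeeping: `2q² − 6q ≤ p + 12 + 13√p − √p·z` with `z > 0` and `p ≥ 289` forces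
`q ≤ √(p/2) − z/3 + 13/2` (using `4/3 ≤ √2 ≤ 99/70`). -/
theorem dsb_real_bookkeeping (p q z : ℝ) (hp : 289 ≤ p) (hz : 0 < z)
    (h : 2 * q ^ 2 - 6 * q ≤ p + 12 + 13 * Real.sqrt p - Real.sqrt p * z) :
    q ≤ Real.sqrt (p / 2) - z / 3 + 13 / 2 := by
  set r := Real.sqrt (p / 2) with hr
  have hr0 : 0 ≤ r := Real.sqrt_nonneg _
  have hrr : r ^ 2 = p / 2 := by rw [hr, Real.sq_sqrt (by linarith)]
  have hr12 : 12 ≤ r := by rw [hr]; exact Real.le_sqrt_of_sq_le (by linarith)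
  set s := Real.sqrt 2 with hs
  have hs0 : 0 ≤ s := Real.sqrt_nonneg _
  have hs2 : s ^ 2 = 2 := by rw [hs, Real.sq_sqrt (by norm_num)]
  have hs_lo : 4 / 3 ≤ s := by rw [hs]; exact Real.le_sqrt_of_sq_le (by norm_num)
  have hs_hi : s ≤ 99 / 70 := by
    rw [hs, show (99 / 70 : ℝ) = Real.sqrt ((99 / 70) ^ 2) by rw [Real.sqrt_sq (by norm_num)]]
    exact Real.sqrt_le_sqrt (by norm_num)
  have hsqrtp : Real.sqrt p = s * r := by
    rw [hs, hr, ← Real.sqrt_mul (by norm_num : (0:ℝ) ≤ 2), mul_div_cancel₀ _ (two_ne_zero)]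
  rw [hsqrtp] at h
  have hp2 : p = 2 * r ^ 2 := by linarith [hrr]
  rw [hp2] at h
  -- h : 2 q² − 6 q ≤ 2 r² + 12 + 13 s r − s r z
  have hsr : 0 ≤ s * r := mul_nonneg hs0 hr0
  by_cases hc : 0 ≤ r - z / 3 + 5
  · -- `(q − 3/2)² ≤ (r − z/3 + 5)²`
    have hA : 0 ≤ (s / 2 - 2 / 3) * (r * z) := mul_nonneg (by linarith) (mul_nonneg hr0 hz.le)
    have hB : 0 ≤ (10 - 13 / 2 * s) * (r - 12) := mul_nonneg (by linarith) (by linarith)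
    have hkey : (q - 3 / 2) ^ 2 ≤ (r - z / 3 + 5) ^ 2 := by
      nlinarith [sq_nonneg (z / 3 - 5), hA, hB]
    have habs : |q - 3 / 2| ≤ |r - z / 3 + 5| := sq_le_sq.1 hkey
    rw [abs_of_nonneg hc] at habs
    have := (abs_le.1 habs).2
    linarith
  · -- the right-hand side is very negative: impossible
    push Not at hc
    have hA : 0 ≤ s * r * (z - 3 * (r + 5)) := mul_nonneg hsr (by linarith)
    have hB : 0 ≤ (s - 4 / 3) * r ^ 2 := mul_nonneg (by linarith) (sq_nonneg r)
    nlinarith [sq_nonneg (q - 3 / 2), hA, hB]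

/-- **The crux implies an additive power below Hanson–Petridis for Sidon Paley cliques.**  `CharPSparseSOS`
(with its exponent `δ`) implies: for all large primes `p`, every SIDON PALEY CLIQUE `Q ⊆ 𝔽_p` — `a − b` is a
non-zero quadratic residue for all `a ≠ b` in `Q` (`legendreSym p (a − b).val = 1`; for `|Q| ≥ 2` this forces
`p ≡ 1 (mod 4)`), and the ordered differences of distinct pairs are pairwise distinct — has
`|Q| ≤ √(p/2) − p^δ/3 + 13/2`.  The bound in print (Hanson–Petridis 2021, Cor. 5, tree p139086) is
`|Q|(|Q| − 1) ≤ (p − 1)/2`, i.e. `|Q| ≤ √(p/2) + 1/2`, and for Sidon cliques that is exactly the counting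
bound; its exact extremal case `|Q|(|Q| − 1) = (p − 1)/2` (Lev–Sonn sets) is classified by Kalmynin 2025,
Thm. 4 — only `p = 5, 13, 41` — i.e. one unit below for `p > 41`.  Hence every proof of the crux improves
Hanson–Petridis(–Kalmynin) by an additive power on the Sidon sub-class. -/
theorem sidonPaleyClique_card_le_of_charPSparseSOS :
    Summit.ValiantsHypothesis.ValiantsHypothesis.Theses.FeketeSOS.CharPSparseSOS →
      ∃ δ : ℝ, 0 < δ ∧ ∃ p₀ : ℕ, ∀ (p : ℕ) [Fact p.Prime], p₀ ≤ p → ∀ Q : Finset (ZMod p),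
        (∀ a ∈ Q, ∀ b ∈ Q, a ≠ b → legendreSym p (a - b).val = 1) →
        (∀ a ∈ Q, ∀ b ∈ Q, ∀ c ∈ Q, ∀ d ∈ Q, a ≠ b → c ≠ d → a - b = c - d → a = c ∧ b = d) →
        (Q.card : ℝ) ≤ Real.sqrt (p / 2) - (p : ℝ) ^ δ / 3 + 13 / 2 := by
  intro hcrux
  obtain ⟨δ, hδ, p₁, H⟩ := dQ_far_from_QR_of_charPSparseSOS hcrux
  refine ⟨δ, hδ, max p₁ 289, ?_⟩
  intro p _ hp Q hclique hsidon
  have hprime : p.Prime := Fact.out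
  have hp₁ : p₁ ≤ p := le_of_max_le_left hp
  have hp289 : 289 ≤ p := le_of_max_le_right hp
  have hp2 : p ≠ 2 := by omega
  have hpR : (289 : ℝ) ≤ (p : ℝ) := by exact_mod_cast hp289
  have hp0 : (0 : ℝ) < (p : ℝ) := by linarith
  -- the eight-square barrier for the representatives of `Q`
  have hbar := H p hp₁ (Q.image ZMod.val) (csq_image_val_lt Q)
  rw [csq_card_image_val Q] at hbar
  -- the error count of a Sidon Paley clique
  have herr := dsb_two_card_err_le hp2 Q hclique hsidon
  have herrR : 2 * (((range p).filter (fun n => (((Q.image ZMod.val).offDiag).filter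
          (fun ab : ℕ × ℕ => (ab.1 + (p - ab.2)) % p = n)).card ≠
            (if n ≠ 0 ∧ legendreSym p n = 1 then 1 else 0))).card : ℝ) ≤
      ((p : ℝ) - 1) - 2 * ((Q.card : ℝ) * Q.card - Q.card) := by exact_mod_cast herr
  -- `p^{1/2+δ} = √p · p^δ`
  have hsplit : (p : ℝ) ^ (1 / 2 + δ) = Real.sqrt p * (p : ℝ) ^ δ := by
    rw [Real.rpow_add hp0, Real.sqrt_eq_rpow]
  set q : ℝ := (Q.card : ℝ) with hq
  have hz0 : 0 < (p : ℝ) ^ δ := by positivity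
  have hmain : 2 * q ^ 2 - 6 * q ≤ p + 12 + 13 * Real.sqrt p - Real.sqrt p * (p : ℝ) ^ δ := by
    rw [← hsplit]
    nlinarith [hbar, herrR]
  exact dsb_real_bookkeeping (p : ℝ) q ((p : ℝ) ^ δ) hpR hz0 hmain


end Summit.ValiantsHypothesis.ValiantsHypothesis.Theorems.CharPSparseSOSTwoCusp
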